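import Summits.AtomisticToContinuum.HydrodynamicLimit.Theorems.AnnealedZeroHorizonAnnealedWeakStrongHsRelEtaCoerciveA
import Summits.AtomisticToContinuum.HydrodynamicLimit.Theorems.CollisionIsometryCLTMacroClosureStubThermoFlux

/-!
# Crux `AnnealedWeakStrong` (stmt-AtomisticToContinuum-9258), line `registered` — the energy-flux
# obstruction to the mean relative-entropy Grönwall (lead dossier R1, kernel-checked)

The heart of the line, `stub_meanRelEntropyGronwall`, needs the Dafermos / Fjordholm–Lye–Mishra–Weber
estimate `|∇ₓDη_σ(Ū) : [F(U) − F(Ū) − DF(Ū)(U − Ū)]| ≤ C · η_σ(U | Ū)` on the states the mollified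
particle fields visit. The `E`-component of the entropy variables is `−1/θ̄`, whose gradient multiplies the
ENERGY-flux remainder. This file shows, with the landed calculus of the hard-sphere fluxes and entropy
(`MacroClosureLine.Barycentric.fderiv_eulerFlux_apply`, `relEnt_stateOf`), that along pure velocity shifts
`U_K = stateOf ρ (u + K e₀) θ` of a dilute physical reference state `Ū = stateOf ρ u θ`:

* `relEnt_velocityShift` — the relative entropy is QUADRATIC: `η_σ(U_K | Ū) = ρ K² / (2θ)`;
* `energyFluxRem_velocityShift` — the energy-flux remainder (direction `e₀`) is CUBIC:
  `R_E(K) = ρ K³/2 + ρ (1 − Z/3) u₀ K²`, `Z = hsCompressibility (ρσ³)`;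
* `energyFluxRem_not_dominated` — hence for every `C` there is a physical state of the SAME density and
  temperature with `C · η_σ(U | Ū) < R_E`: no constant closes the Grönwall without a positive-time bound
  on third velocity moments of the mollified fields, which neither `MeanFluxClosure` nor `MeanSecondLaw`
  supplies (dossier `Cruxes/AnnealedWeakStrong/LeadC1-S2-dossier.md`, R1).

`AWS.hsRelEta σ U V = MacroClosureLine.relEnt σ U V` and `AWS.consState = MacroClosureLine.stateOf` hold by
`rfl` (`hsRelEta_eq_relEnt`, `consState_eq_stateOf` of the landed S3a file `…HsRelEtaCoerciveA`), so the
statements are about the line's own objects.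
References: Dafermos1979; FjordholmEtAl2020 (Lemma 28); BrezinaFeireisl2018 (§3).
-/

noncomputable section

open Set

namespace Summit.AtomisticToContinuum.HydrodynamicLimit.Theorems.AWS

open Literature.MathematicalPhysics.KineticTheory Literature.Analysis.FluidPDE
open Summit.AtomisticToContinuum.HydrodynamicLimit.Theorems.MacroClosureLine
open Summit.AtomisticToContinuum.HydrodynamicLimit.Theorems.MacroClosureLine.Barycentric

/-- The first basis vector `e₀` of `V3`. -/
def e0 : V3 := EuclideanSpace.single 0 (1 : ℝ)

/-- Coordinate `0` of `u + K e₀`. -/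
theorem velocityShift_apply_zero (u : V3) (K : ℝ) : (u + K • e0) 0 = u 0 + K := by
  simp [e0]

variable {η₀ : ℝ} {F : ℝ → ℝ}

/-- **The relative entropy along a velocity shift is quadratic**: `η_σ(U_K | Ū) = ρK²/(2θ)` for
`U_K = stateOf ρ (u + K e₀) θ`, `Ū = stateOf ρ u θ` dilute physical. -/
theorem relEnt_velocityShift (hFa : AnalyticOnNhd ℝ F (Ioo (-η₀) η₀))
    (hF : EqOn hsExcessFreeEnergy F (Ico 0 η₀)) {σ ρ θ : ℝ} (u : V3) (hσ : 0 < σ) (hρ : 0 < ρ)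
    (hθ : 0 < θ) (hx : ρ * σ ^ 3 < η₀) (K : ℝ) :
    relEnt σ (stateOf ρ (u + K • e0) θ) (stateOf ρ u θ) = ρ * K ^ 2 / (2 * θ) := by
  rw [relEnt_stateOf hFa hF u hσ hρ hθ hx hρ.ne' (u + K • e0) θ]
  have h1 : u + K • e0 - u = K • e0 := by abel
  have he : ‖e0‖ = 1 := by simp [e0]
  rw [h1, norm_smul, he, mul_one, Real.norm_eq_abs, sq_abs, div_self hθ.ne']
  simp only [sub_self]
  ring

/-- **The energy-flux remainder along a velocity shift is cubic**:
`(F₀(U_K) − F₀(Ū) − DF₀(Ū)(U_K − Ū)).E = ρK³/2 + ρ(1 − Z/3) u₀ K²`, `Z = hsCompressibility (ρσ³)`. -/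
theorem energyFluxRem_velocityShift (hFa : AnalyticOnNhd ℝ F (Ioo (-η₀) η₀))
    (hF : EqOn hsExcessFreeEnergy F (Ico 0 η₀)) {σ ρ θ : ℝ} (u : V3) (hσ : 0 < σ) (hρ : 0 < ρ)
    (hθ : 0 < θ) (hx : ρ * σ ^ 3 < η₀) (K : ℝ) :
    (fluxRem σ 0 (stateOf ρ (u + K • e0) θ) (stateOf ρ u θ)).2.2 =
      ρ * K ^ 3 / 2 + ρ * (1 - hsCompressibility (ρ * σ ^ 3) / 3) * u 0 * K ^ 2 := by
  unfold fluxRem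
  simp only [Prod.snd_sub]
  rw [eulerFlux_stateOf σ hρ.ne' (u + K • e0) θ 0, eulerFlux_stateOf σ hρ.ne' u θ 0,
    fderiv_eulerFlux_apply hFa hF u hσ hρ hθ hx 0]
  simp only [Prod.fst_sub, Prod.snd_sub, stateOf_fst, stateOf_snd_fst, stateOf_snd_snd,
    velocityShift_apply_zero, sub_self]
  have hm : (ρ • (u + K • e0) - ρ • u : V3) = (ρ * K) • e0 := by
    rw [← smul_sub, add_sub_cancel_left, smul_smul]
  have hm0 : (ρ • (u + K • e0) - ρ • u : V3) 0 = ρ * K := by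
    rw [hm]; simp [e0]
  have hinner : inner ℝ u (ρ • (u + K • e0) - ρ • u : V3) = ρ * K * u 0 := by
    rw [hm, real_inner_smul_right, e0, EuclideanSpace.inner_single_right]
    simp
  have hnorm : ‖u + K • e0‖ ^ 2 = ‖u‖ ^ 2 + 2 * K * u 0 + K ^ 2 := by
    rw [norm_add_sq_real, real_inner_smul_right, e0, EuclideanSpace.inner_single_right, norm_smul,
      Real.norm_eq_abs, mul_pow, sq_abs]
    simp; ring
  rw [hm0, hinner, hnorm]
  field_simp
  ring

/-- **R1, kernel-checked: the relative energy flux is not dominated by the relative entropy.** At every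
dilute physical reference state and for every constant `C` there is a physical state of the same density
and temperature (a velocity shift) whose energy-flux remainder exceeds `C` times its relative entropy
(stated with the line's `hsRelEta` / `consState`). -/
theorem energyFluxRem_not_dominated (hFa : AnalyticOnNhd ℝ F (Ioo (-η₀) η₀))
    (hF : EqOn hsExcessFreeEnergy F (Ico 0 η₀)) {σ ρ θ : ℝ} (u : V3) (hσ : 0 < σ) (hρ : 0 < ρ)
    (hθ : 0 < θ) (hx : ρ * σ ^ 3 < η₀) (C : ℝ) :
    ∃ K : ℝ, 0 < K ∧
      C * hsRelEta σ (consState ρ (u + K • e0) θ) (consState ρ u θ) <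
        (fluxRem σ 0 (consState ρ (u + K • e0) θ) (consState ρ u θ)).2.2 := by
  simp only [hsRelEta_eq_relEnt, consState_eq_stateOf]
  set Z := hsCompressibility (ρ * σ ^ 3) with hZ
  -- choose K larger than every competing coefficient
  set K : ℝ := 1 + |C| / θ + 2 * |(1 - Z / 3) * u 0| with hK
  have hK0 : 0 < K := by positivity
  refine ⟨K, hK0, ?_⟩
  rw [relEnt_velocityShift hFa hF u hσ hρ hθ hx K, energyFluxRem_velocityShift hFa hF u hσ hρ hθ hx K]
  -- reduce to `C/θ + 2(1 - Z/3)u₀·(-1) < K`-type inequality after dividing by `ρ K² / 2 > 0`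
  have hK1 : |C| / θ < K := by
    have : 0 ≤ 2 * |(1 - Z / 3) * u 0| := by positivity
    linarith
  have hK2 : -(2 * ((1 - Z / 3) * u 0)) ≤ 2 * |(1 - Z / 3) * u 0| := by
    have := neg_abs_le ((1 - Z / 3) * u 0)
    linarith
  have hCθ : C / θ ≤ |C| / θ := div_le_div_of_nonneg_right (le_abs_self C) hθ.le
  have hkey : C / θ < K + 2 * ((1 - Z / 3) * u 0) := by linarith
  have hρK : 0 < ρ * K ^ 2 / 2 := by positivity
  have h := mul_lt_mul_of_pos_left hkey hρK
  have hlhs : C * (ρ * K ^ 2 / (2 * θ)) = ρ * K ^ 2 / 2 * (C / θ) := by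
    field_simp
  have hrhs : ρ * K ^ 3 / 2 + ρ * (1 - Z / 3) * u 0 * K ^ 2 =
      ρ * K ^ 2 / 2 * (K + 2 * ((1 - Z / 3) * u 0)) := by ring
  rw [hlhs, hrhs]
  exact h

/-- **Registered bookkeeping stub `stub_energyFluxObstruction`** (line `registered`, crux
stmt-AtomisticToContinuum-9258; lead evidence for the dead heart S2): given the hard-sphere EOS fact
(analytic excess free energy on a band, `ImplosionDichotomy.HsEosLowDensity`, landed), at every dilute
physical reference state the energy-flux Taylor remainder is not bounded by any constant multiple of the
relative entropy `hsRelEta`. -/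
theorem stub_energyFluxObstruction :
    ∀ (η₀ : ℝ) (F : ℝ → ℝ), AnalyticOnNhd ℝ F (Ioo (-η₀) η₀) → EqOn hsExcessFreeEnergy F (Ico 0 η₀) →
      ∀ (σ ρ θ : ℝ) (u : V3), 0 < σ → 0 < ρ → 0 < θ → ρ * σ ^ 3 < η₀ → ∀ C : ℝ,
        ∃ K : ℝ, 0 < K ∧
          C * hsRelEta σ (consState ρ (u + K • e0) θ) (consState ρ u θ) <
            (fluxRem σ 0 (consState ρ (u + K • e0) θ) (consState ρ u θ)).2.2 :=
  fun _ _ hFa hF _ _ _ u hσ hρ hθ hx C => energyFluxRem_not_dominated hFa hF u hσ hρ hθ hx C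

end Summit.AtomisticToContinuum.HydrodynamicLimit.Theorems.AWS

end
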